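import Literature.NumberTheory.EllipticCurves.SemilinearLocalCohomology
import HarnessLib

/-!
# Semilinear structures on `μₙ`, on Tate duals `Hom(M, μₙ)` and on `E[n]`: the coefficient data of
# the outer Galois action on `H¹(K_v, M^D)` and `H²(K_v, μₙ)`

Companion of `SemilinearLocalCohomology.lean` (`IsSemilinear`, `semilinearLocalH`, compatibility with
cup products). For a lift `τ` of `σ ∈ Aut(K/k)` to `K̄` this file constructs the `τ`-SEMILINEAR
ENDOMORPHISMS (`ψ (ρ(τ⁻¹ g τ) m) = ρ(g) (ψ m)`) of

* `μₙ(K̄)` — `muSemilinearMap τ n : ζ ↦ τ ζ` (`isSemilinear_mu`), with the composition law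
  `muSemilinearMap τ₂ ∘ muSemilinearMap τ = μ(γ)` when `τ₂ τ = γ ∈ Γ_K` (`muSemilinearMap_comp`);
* a Tate dual `M^D = Hom(M, μₙ)` — `tateDualSemilinearMap : f ↦ ψ_μ ∘ f ∘ ψ_M⁻¹` for semilinear
  `ψ_M` (with inverse `ψ_M'`) and `ψ_μ` (`isSemilinear_tateDual`), the composition law
  (`tateDualSemilinearMap_comp`), and **compatibility with the evaluation pairing**
  `⟨ψ_M m, ψ^D f⟩ = ψ_μ ⟨m, f⟩` (`tateDualEval_semilinear`) — the hypothesis `hBψ` of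
  `semilinearLocalH_cupProduct` for the pairing of local Tate duality (`tateDualPairing`);
* `E[n]` — the inverse and composition laws of `IsLiftOfAut.torsionMap` (`torsionMap_symm_apply`,
  `torsionMap_comp_eq_smul`), i.e. the hypotheses `hinv`, `hψψ` above for `ψ_M = τ` on points.

Purpose (T1 JET road K, stub S1 dual side): with these, `semilinearLocalH` gives `σ_*` on
`H¹(K_v, E[n]^D)` and on `H²(K_v, μₙ)`, `σ_*(x ∪ y) = σ_* x ∪ σ_* y` for the local Tate pairing
(Jetchev 2008 §5 Thm. 5.1 «with respect to `∑_v ⟨,⟩_v^±`»), and the only remaining input is the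
compatibility `inv_{σv} ∘ σ_* = inv_v` of the invariant maps. Everything is PROVED; no named facts, no
instances, no notation.

## References

* J. S. Milne, *Arithmetic Duality Theorems* (2006), Ch. I §0 (`(σf)(m) = σ f(σ⁻¹ m)`), Cor. 2.3.
  [MilneADT2006]
* J. Neukirch, A. Schmidt, K. Wingberg, *Cohomology of Number Fields* (2008), I §5. [NeukirchSchmidtWingberg2008]
* D. Jetchev, Compos. Math. 144 (2008), §5 Thm. 5.1. [Jetchev2008]
-/

noncomputable section

open scoped Classical
open Field WeierstrassCurve
open Literature.NumberTheory.GaloisRepresentations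
open Literature.NumberTheory.GaloisRepresentations.DiscreteGaloisModule (mu MuCarrier TateDual
  tateDualEval)

universe u v

namespace Literature.NumberTheory.EllipticCurves

/-! ### `μₙ` -/

section Mu

variable {k : Type v} {K : Type u} [Field k] [Field K] [Algebra k K]
variable {σ : K ≃ₐ[k] K} {τ τ₂ : AlgebraicClosure K ≃+* AlgebraicClosure K}

/-- Two elements of `μₙ(K̄)` (additive carrier) with the same value in `K̄` are equal.
[cite: MilneADT2006, Ch. I §0] -/
theorem MuCarrier.eq_of_coe_eq {n : ℕ} {a b : MuCarrier K n}
    (h : (((MuCarrier.toAdditive a).toMul : (AlgebraicClosure K)ˣ) : AlgebraicClosure K) =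
      (((MuCarrier.toAdditive b).toMul : (AlgebraicClosure K)ˣ) : AlgebraicClosure K)) : a = b :=
  MuCarrier.toAdditive.injective (Additive.toMul.injective (Subtype.ext (Units.ext h)))

/-- The value in `K̄` of `σ • ζ` for `σ ∈ Γ_K`, `ζ ∈ μₙ`. [cite: MilneADT2006, Ch. I §0] -/
theorem coe_mu_apply {n : ℕ} (g : absoluteGaloisGroup K) (ζ : MuCarrier K n) :
    (((MuCarrier.toAdditive (mu K n g ζ)).toMul : (AlgebraicClosure K)ˣ) : AlgebraicClosure K) =
      g • (((MuCarrier.toAdditive ζ).toMul : (AlgebraicClosure K)ˣ) : AlgebraicClosure K) := by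
  rw [DiscreteGaloisModule.mu_apply_apply, toMul_ofMul, absoluteGaloisGroup.coe_smul_rootsOfUnity,
    Units.coe_smul]

/-- **`τ` on `μₙ(K̄)`**: the restriction of the ring automorphism `τ` of `K̄` to the `n`-th roots
of unity (Mathlib `restrictRootsOfUnity`), written additively. [cite: MilneADT2006, Ch. I §0] -/
def muSemilinearMap (τ : AlgebraicClosure K ≃+* AlgebraicClosure K) (n : ℕ) :
    MuCarrier K n →+ MuCarrier K n :=
  MonoidHom.toAdditive (restrictRootsOfUnity τ.toRingHom n)

/-- The value in `K̄` of `muSemilinearMap τ n ζ` is `τ ζ`. [cite: MilneADT2006, Ch. I §0] -/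
theorem coe_muSemilinearMap (τ : AlgebraicClosure K ≃+* AlgebraicClosure K) (n : ℕ)
    (ζ : MuCarrier K n) :
    (((MuCarrier.toAdditive (muSemilinearMap τ n ζ)).toMul : (AlgebraicClosure K)ˣ) :
        AlgebraicClosure K) =
      τ (((MuCarrier.toAdditive ζ).toMul : (AlgebraicClosure K)ˣ) : AlgebraicClosure K) := rfl

/-- **`ζ ↦ τ ζ` is `τ`-semilinear on `μₙ`**: `τ ((τ⁻¹ g τ) ζ) = g (τ ζ)`.
[cite: NeukirchSchmidtWingberg2008, I §5] -/
theorem isSemilinear_mu (hτ : IsLiftOfAut σ τ) (n : ℕ) :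
    IsSemilinear (mu K n) hτ (muSemilinearMap τ n) := by
  intro g ζ
  apply MuCarrier.eq_of_coe_eq
  rw [coe_muSemilinearMap, coe_mu_apply, coe_mu_apply, coe_muSemilinearMap]
  change τ (τ.symm ((show AlgebraicClosure K ≃ₐ[K] AlgebraicClosure K from g) (τ _))) = _
  rw [RingEquiv.apply_symm_apply]
  rfl

/-- **Composition law on `μₙ`**: if `τ₂ ∘ τ = γ ∈ Γ_K` on `K̄` then
`muSemilinearMap τ₂ ∘ muSemilinearMap τ = μₙ(γ)`. [cite: MilneADT2006, Ch. I §0] -/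
theorem muSemilinearMap_comp (n : ℕ) {γ : absoluteGaloisGroup K}
    (hγ : ∀ x, τ₂ (τ x) = γ • x) (ζ : MuCarrier K n) :
    muSemilinearMap τ₂ n (muSemilinearMap τ n ζ) = mu K n γ ζ := by
  apply MuCarrier.eq_of_coe_eq
  rw [coe_muSemilinearMap, coe_muSemilinearMap, coe_mu_apply, hγ]

end Mu

/-! ### Tate duals -/

section TateDualSection

variable {k : Type v} {K : Type u} [Field k] [Field K] [Algebra k K]
variable {M : Type u} [AddCommGroup M] [TopologicalSpace M] [DiscreteTopology M] [Finite M]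
variable (ρ : DiscreteGaloisModule K M) (n : ℕ)
variable {σ : K ≃ₐ[k] K} {τ : AlgebraicClosure K ≃+* AlgebraicClosure K}

/-- **The semilinear endomorphism `f ↦ ψ_μ ∘ f ∘ ψ_M'` of `Hom(M, μₙ)`** attached to endomorphisms
`ψ_μ` of `μₙ` and `ψ_M'` of `M` (intended: `ψ_μ = τ` on `μₙ`, `ψ_M'` the INVERSE of a `τ`-semilinear
`ψ_M`), i.e. `(τ f)(m) = τ (f (τ⁻¹ m))` — the rule `(σf)(m) = σ f(σ⁻¹ m)` for an automorphism not
fixing `K`. [cite: MilneADT2006, Ch. I §0 (action on `Hom(M, N)`)] -/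
def tateDualSemilinearMap (ψμ : MuCarrier K n →+ MuCarrier K n) (ψM' : M →+ M) :
    TateDual K M n →+ TateDual K M n where
  toFun f := ((ψμ.comp ((f : M →+ Additive (rootsOfUnity n (AlgebraicClosure K))).comp ψM')) :
    M →+ Additive (rootsOfUnity n (AlgebraicClosure K)))
  map_zero' := AddMonoidHom.ext fun _ => map_zero ψμ
  map_add' _ _ := AddMonoidHom.ext fun _ => map_add ψμ _ _

omit [TopologicalSpace M] [DiscreteTopology M] [Finite M] in
/-- Unfolding `tateDualSemilinearMap`: `(ψ^D f) m = ψ_μ (f (ψ_M' m))`.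
[cite: MilneADT2006, Ch. I §0] -/
theorem tateDualSemilinearMap_apply (ψμ : MuCarrier K n →+ MuCarrier K n) (ψM' : M →+ M)
    (f : TateDual K M n) (m : M) : tateDualSemilinearMap n ψμ ψM' f m = ψμ (f (ψM' m)) := rfl

variable {ρ n}

/-- **`ψ^D` is `τ`-semilinear on `M^D`** when `ψ_M` is `τ`-semilinear on `M` with two-sided inverse
`ψ_M'` and `ψ_μ` is `τ`-semilinear on `μₙ`. [cite: MilneADT2006, Ch. I §0]
[cite: NeukirchSchmidtWingberg2008, I §5] -/
theorem isSemilinear_tateDual (hτ : IsLiftOfAut σ τ) {ψM ψM' : M →+ M}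
    (hψM : IsSemilinear ρ hτ ψM) (hinv : ∀ m, ψM (ψM' m) = m) (hinv' : ∀ m, ψM' (ψM m) = m)
    {ψμ : MuCarrier K n →+ MuCarrier K n} (hψμ : IsSemilinear (mu K n) hτ ψμ) :
    IsSemilinear (ρ.tateDual n) hτ (tateDualSemilinearMap n ψμ ψM') := by
  intro g f
  refine DiscreteGaloisModule.TateDual.ext fun m => ?_
  rw [tateDualSemilinearMap_apply, DiscreteGaloisModule.tateDual_apply_apply_apply,
    DiscreteGaloisModule.tateDual_apply_apply_apply, tateDualSemilinearMap_apply, hψμ]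
  congr 2
  -- `ρ (τ⁻¹gτ)⁻¹ (ψ_M' m) = ψ_M' (ρ g⁻¹ m)`
  have h := hψM g⁻¹ (ψM' m)
  rw [map_inv, hinv] at h
  rw [← h, hinv']

omit [TopologicalSpace M] [DiscreteTopology M] [Finite M] in
/-- **The evaluation pairing is compatible with the semilinear maps**: `⟨ψ_M m, ψ^D f⟩ = ψ_μ ⟨m, f⟩`
(the hypothesis `hBψ` of `semilinearLocalH_cupProduct` for `tateDualPairing`).
[cite: MilneADT2006, Ch. I Cor. 2.3] -/
theorem tateDualEval_semilinear {ψM ψM' : M →+ M} (hinv' : ∀ m, ψM' (ψM m) = m)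
    (ψμ : MuCarrier K n →+ MuCarrier K n) (m : M) (f : TateDual K M n) :
    tateDualEval K M n (ψM m) (tateDualSemilinearMap n ψμ ψM' f) =
      ψμ (tateDualEval K M n m f) := by
  rw [DiscreteGaloisModule.tateDualEval_apply, DiscreteGaloisModule.tateDualEval_apply,
    tateDualSemilinearMap_apply, hinv']

omit [Finite M] in
/-- Inverses compose contravariantly: if `ψ_M₂ ∘ ψ_M = ρ(γ)` then `ψ_M' ∘ ψ_M₂' = ρ(γ⁻¹)` for a left
inverse `ψ_M'` of `ψ_M` and a left inverse `ψ_M₂'` of `ψ_M₂`. [cite: MilneADT2006, Ch. I §0] -/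
theorem inv_comp_inv_eq_of_comp_eq {ψM ψM' ψM₂ ψM₂' : M →+ M} (hinv' : ∀ m, ψM' (ψM m) = m)
    (hinv₂' : ∀ m, ψM₂' (ψM₂ m) = m)
    {γ : absoluteGaloisGroup K} (hM : ∀ m, ψM₂ (ψM m) = ρ γ m) (m : M) :
    ψM' (ψM₂' m) = ρ γ⁻¹ m := by
  have h1 : ψM₂ (ψM (ρ γ⁻¹ m)) = m := by
    rw [hM, ← Module.End.mul_apply, ← map_mul, mul_inv_cancel, map_one, Module.End.one_apply]
  have h2 : ψM (ρ γ⁻¹ m) = ψM₂' m := by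
    have := congrArg ψM₂' h1
    rwa [hinv₂'] at this
  have h3 := congrArg ψM' h2
  rw [hinv'] at h3
  exact h3.symm

/-- **Composition law on `M^D`**: if `ψ_μ₂ ∘ ψ_μ = μ(γ)` and `ψ_M' ∘ ψ_M₂' = ρ(γ⁻¹)` then
`ψ^D₂ ∘ ψ^D = ρ^D(γ)` (`(γ f)(m) = γ f(γ⁻¹ m)`). [cite: MilneADT2006, Ch. I §0] -/
theorem tateDualSemilinearMap_comp {ψM' ψM₂' : M →+ M} {ψμ ψμ₂ : MuCarrier K n →+ MuCarrier K n}
    {γ : absoluteGaloisGroup K} (hμ : ∀ ζ, ψμ₂ (ψμ ζ) = mu K n γ ζ)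
    (hM' : ∀ m, ψM' (ψM₂' m) = ρ γ⁻¹ m) (f : TateDual K M n) :
    tateDualSemilinearMap n ψμ₂ ψM₂' (tateDualSemilinearMap n ψμ ψM' f) = ρ.tateDual n γ f := by
  refine DiscreteGaloisModule.TateDual.ext fun m => ?_
  rw [tateDualSemilinearMap_apply, tateDualSemilinearMap_apply, hμ, hM',
    DiscreteGaloisModule.tateDual_apply_apply_apply]

end TateDualSection

/-! ### `E[n]`: inverse and composition laws of `τ` on points -/

section Torsion

variable {k : Type v} {K : Type u} [Field k] [Field K] [Algebra k K] (W : WeierstrassCurve k)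
variable {σ σ₂ : K ≃ₐ[k] K} {τ τ₂ : AlgebraicClosure K ≃+* AlgebraicClosure K}

/-- The inverse of a lift of `σ` lifts `σ⁻¹`. [cite: GrossLMS1991, §5 (5.1)] -/
theorem IsLiftOfAut.symm_isLiftOfAut (hτ : IsLiftOfAut σ τ) : IsLiftOfAut σ.symm τ.symm :=
  hτ.symm_apply

/-- `τ⁻¹ (τ P) = P` on `E[n]`. [cite: GrossLMS1991, §5 (5.1)] -/
theorem IsLiftOfAut.torsionMap_symm_apply (hτ : IsLiftOfAut σ τ) (n : ℤ)
    (P : geomTorsion (W.baseChange K) n) :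
    hτ.symm_isLiftOfAut.torsionMap W n (hτ.torsionMap W n P) = P := by
  apply Subtype.ext
  change hτ.symm_isLiftOfAut.pointsMap W (hτ.pointsMap W P) = (P : geomPoints _)
  generalize (P : geomPoints (W.baseChange K)) = R
  change ((W.baseChange K).baseChange (AlgebraicClosure K)).toAffine.Point at R
  rcases R with _ | ⟨x, y, h⟩
  · rfl
  · exact Affine.Point.some_eq_some_of_eq (τ.symm_apply_apply x) (τ.symm_apply_apply y)

/-- `τ (τ⁻¹ P) = P` on `E[n]`. [cite: GrossLMS1991, §5 (5.1)] -/
theorem IsLiftOfAut.torsionMap_apply_symm (hτ : IsLiftOfAut σ τ) (n : ℤ)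
    (P : geomTorsion (W.baseChange K) n) :
    hτ.torsionMap W n (hτ.symm_isLiftOfAut.torsionMap W n P) = P := by
  apply Subtype.ext
  change hτ.pointsMap W (hτ.symm_isLiftOfAut.pointsMap W P) = (P : geomPoints _)
  generalize (P : geomPoints (W.baseChange K)) = R
  change ((W.baseChange K).baseChange (AlgebraicClosure K)).toAffine.Point at R
  rcases R with _ | ⟨x, y, h⟩
  · rfl
  · exact Affine.Point.some_eq_some_of_eq (τ.apply_symm_apply x) (τ.apply_symm_apply y)

/-- **Composition law on `E[n]`**: if `τ₂ ∘ τ = γ ∈ Γ_K` on `K̄` then `τ₂ (τ P) = γ • P` on points.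
[cite: GrossLMS1991, §5 (5.1)] -/
theorem IsLiftOfAut.torsionMap_comp_eq_smul (hτ : IsLiftOfAut σ τ) (hτ₂ : IsLiftOfAut σ₂ τ₂)
    (n : ℤ) {γ : absoluteGaloisGroup K} (hγ : ∀ x, τ₂ (τ x) = γ • x)
    (P : geomTorsion (W.baseChange K) n) :
    hτ₂.torsionMap W n (hτ.torsionMap W n P) = γ • P := by
  apply Subtype.ext
  change hτ₂.pointsMap W (hτ.pointsMap W P) = γ • (P : geomPoints _)
  generalize (P : geomPoints (W.baseChange K)) = R
  change ((W.baseChange K).baseChange (AlgebraicClosure K)).toAffine.Point at R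
  rcases R with _ | ⟨x, y, h⟩
  · rfl
  · exact Affine.Point.some_eq_some_of_eq (hγ x) (hγ y)

/-- The composition law in the shape of the hypothesis `hψψ` of
`semilinearLocalH_one_semilinearLocalH_one` for `ρ = E[n]`, `ψ = τ`. [cite: GrossLMS1991, §5 (5.1)] -/
theorem IsLiftOfAut.torsionMap_comp_eq_apply (hτ : IsLiftOfAut σ τ) (hτ₂ : IsLiftOfAut σ₂ τ₂)
    (n : ℤ) (γ : absoluteGaloisGroup K) (hγ : ∀ x, τ₂ (τ x) = γ • x)
    (P : geomTorsion (W.baseChange K) n) :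
    hτ₂.torsionMap W n (hτ.torsionMap W n P) = (W.baseChange K).torsionGaloisModule n γ P := by
  rw [WeierstrassCurve.torsionGaloisModule_apply_apply]
  exact IsLiftOfAut.torsionMap_comp_eq_smul W hτ hτ₂ n hγ P

end Torsion

end Literature.NumberTheory.EllipticCurves

end
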